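import Mathlib.RingTheory.Regular.RegularSequence
import Mathlib.RingTheory.Ideal.Operations
import Mathlib.RingTheory.Ideal.Maps
import HarnessLib

/-!
# The centre of Kawasaki's Cohen–Macaulay blowing up

Topic: `Literature/AlgebraicGeometry/Resolution`. For a sequence `xs = [x_t, …, x_d]` of ring
elements, Kawasaki's centre is the product ideal

  `kawasakiCenter xs = ∏_{i < |xs|} (xs.drop i) = (x_t, …, x_d) (x_{t+1}, …, x_d) ⋯ (x_d)`,

Kawasaki 2000, Thm. 4.1 / Cor. 4.2 (`𝔟_{s,t} = q_t ⋯ q_{s+1}` with `qᵢ = (xᵢ, …, x_d)`, for the type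
`s = d - 1`) = Česnavičius 2021, Thm. 3.13 (`I = ∏_{u=1}^{σ} (r₁, …, r_u)` for `r = xs.reverse`), and
the local form of the global centre `𝔟 = ∏_{i=1}^{s+1} (z_i, …, z_d)` of Kawasaki 2000, Thm. 5.1
(p. 2539). This file fixes the definition and its elementary API, so that the statement of the
Cohen–Macaulay blowing-up theorem and the globalization can share it:

* `kawasakiCenter_nil / _cons / _singleton` — recursion `𝔟(x :: xs) = (x :: xs) · 𝔟(xs)`;
* `kawasakiCenter_map` — compatibility with ring maps (localization at a point, completion, charts);
* `kawasakiCenter_le_ofList` — `𝔟(xs) ⊆ (xs)`;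
* `span_pow_length_le_kawasakiCenter` — `(x_d)^{|xs|} ⊆ 𝔟(xs)` for the last entry `x_d`, so that
  `V(𝔟(xs)) = V(x_d)` set-theoretically when `xs ≠ []`;
* `kawasakiCenter_ne_bot` — over a domain the centre of a sequence of non-zero elements is
  non-zero (the blowing up is birational).

Everything is proved; no named fact is introduced.

## References

* [Kawasaki2000] T. Kawasaki, *On Macaulayfication of Noetherian schemes*, Trans. AMS 352 (2000),
  Thm. 4.1, Cor. 4.2, Thm. 5.1.
* [Cesnavicius2021] K. Česnavičius, *Macaulayfication of Noetherian schemes*, Duke Math. J. 170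
  (2021), Thm. 3.13.
-/

namespace Literature.AlgebraicGeometry.Resolution

universe u

variable {R : Type u} [CommRing R]

/-- **Kawasaki's centre**: for `xs = [x_t, …, x_d]` the product ideal
`∏_{i < |xs|} (xs.drop i) = (x_t,…,x_d)(x_{t+1},…,x_d) ⋯ (x_d)`.
[cite: Kawasaki2000, Thm. 4.1; Cesnavicius2021, Thm. 3.13] -/
def kawasakiCenter (xs : List R) : Ideal R :=
  ((List.range xs.length).map fun i => Ideal.ofList (xs.drop i)).prod

/-- The centre of the empty sequence is the unit ideal. [folklore] -/
@[simp] theorem kawasakiCenter_nil : kawasakiCenter ([] : List R) = ⊤ := by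
  simp [kawasakiCenter]

/-- Recursion: `𝔟(x :: xs) = (x :: xs) · 𝔟(xs)`. [folklore] -/
theorem kawasakiCenter_cons (x : R) (xs : List R) :
    kawasakiCenter (x :: xs) = Ideal.ofList (x :: xs) * kawasakiCenter xs := by
  simp only [kawasakiCenter, List.length_cons, List.range_succ_eq_map, List.map_cons,
    List.drop_zero, List.map_map, List.prod_cons]
  rfl

/-- The centre of a singleton `[x]` is `(x)`. [folklore] -/
theorem kawasakiCenter_singleton (x : R) : kawasakiCenter [x] = Ideal.span {x} := by
  rw [kawasakiCenter_cons, kawasakiCenter_nil, Ideal.mul_top, Ideal.ofList_singleton]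

/-- The centre is compatible with ring homomorphisms: `𝔟(xs) S = 𝔟(f xs)`. [folklore] -/
theorem kawasakiCenter_map {S : Type u} [CommRing S] (f : R →+* S) (xs : List R) :
    (kawasakiCenter xs).map f = kawasakiCenter (xs.map f) := by
  induction xs with
  | nil => simp [Ideal.map_top]
  | cons x xs ih =>
    rw [kawasakiCenter_cons, List.map_cons, kawasakiCenter_cons, Ideal.map_mul, ih,
      Ideal.map_ofList, List.map_cons]

/-- `𝔟(xs) ⊆ (xs)` for a non-empty sequence (the first factor). [folklore] -/
theorem kawasakiCenter_le_ofList {xs : List R} (hxs : xs ≠ []) :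
    kawasakiCenter xs ≤ Ideal.ofList xs := by
  obtain ⟨x, xs, rfl⟩ := List.exists_cons_of_ne_nil hxs
  rw [kawasakiCenter_cons]
  exact Ideal.mul_le_right

/-- Every factor `(xs.drop i)` contains the last entry, so `(x_d)^{|xs|} ⊆ 𝔟(xs)`. [folklore] -/
theorem span_pow_length_le_kawasakiCenter (xs : List R) (x : R) (hx : ∀ i < xs.length, x ∈ xs.drop i) :
    Ideal.span {x} ^ xs.length ≤ kawasakiCenter xs := by
  induction xs with
  | nil => simp
  | cons y ys ih =>
    rw [kawasakiCenter_cons, List.length_cons, pow_succ']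
    refine Ideal.mul_mono ?_ (ih fun i hi => ?_)
    · rw [Ideal.span_singleton_le_iff_mem]
      exact Ideal.subset_span (by simpa using hx 0 (by simp))
    · simpa using hx (i + 1) (by simpa using hi)

omit [CommRing R] in
/-- The last entry of a non-empty list lies in every `xs.drop i`, `i < |xs|`. [folklore] -/
theorem getLast_mem_drop {xs : List R} (hxs : xs ≠ []) (i : ℕ) (hi : i < xs.length) :
    xs.getLast hxs ∈ xs.drop i := by
  have hne : xs.drop i ≠ [] := by
    simpa [List.drop_eq_nil_iff] using hi
  rw [← List.getLast_drop hne]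
  exact List.getLast_mem hne

/-- `(x_d)^{|xs|} ⊆ 𝔟(xs) ⊆ (xs)` for the last entry `x_d`: set-theoretically `V(𝔟(xs)) = V(x_d) ∪ V(xs)
= V(x_d)`. [folklore] -/
theorem span_getLast_pow_le_kawasakiCenter {xs : List R} (hxs : xs ≠ []) :
    Ideal.span {xs.getLast hxs} ^ xs.length ≤ kawasakiCenter xs :=
  span_pow_length_le_kawasakiCenter xs _ fun i hi => getLast_mem_drop hxs i hi

/-- Over a domain, the centre of a sequence with non-zero last entry is non-zero (so the blowing up
along it is birational). [folklore] -/
theorem kawasakiCenter_ne_bot [IsDomain R] {xs : List R} (hxs : xs ≠ []) (hx : xs.getLast hxs ≠ 0) :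
    kawasakiCenter xs ≠ ⊥ := by
  intro h
  have hle := span_getLast_pow_le_kawasakiCenter hxs
  rw [h, le_bot_iff, ← Ideal.zero_eq_bot, pow_eq_zero_iff (List.length_pos_iff.mpr hxs).ne',
    Ideal.zero_eq_bot, Ideal.span_singleton_eq_bot] at hle
  exact hx hle


/-! ## Local form of a global centre

In the globalization (Kawasaki 2000, proof of Thm. 5.1, p. 2539) the centre is `𝔟 = ∏ᵢ (zᵢ, …, z_d)`
for GLOBAL `z₁, …, z_d`; at a point where `z₁, …, z_{t-1}` are units and `z_t, …, z_d` lie in the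
maximal ideal, the factors `(zᵢ, …, z_d)`, `i < t`, are the unit ideal and `𝔟` becomes the centre
of the shorter sequence `z_t, …, z_d`. -/

/-- An `ofList` ideal containing a unit is the unit ideal. [folklore] -/
theorem ofList_eq_top_of_isUnit_mem {xs : List R} {a : R} (ha : a ∈ xs) (hu : IsUnit a) :
    Ideal.ofList xs = ⊤ :=
  Ideal.eq_top_of_isUnit_mem _ (Ideal.subset_span ha) hu

/-- **Local form of the centre**: if all entries of `as` are units then
`𝔟(as ++ bs) = 𝔟(bs)` (the factors starting inside `as` contain a unit). [cite: Kawasaki2000,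
proof of Thm. 5.1 (`𝔟 R_(p) = ∏_{i=t}^{s+1} (x_i, …, x_d) R_(p)`)] -/
theorem kawasakiCenter_append_of_isUnit (as bs : List R) (h : ∀ a ∈ as, IsUnit a) :
    kawasakiCenter (as ++ bs) = kawasakiCenter bs := by
  induction as with
  | nil => rfl
  | cons a as ih =>
    rw [List.cons_append, kawasakiCenter_cons,
      ofList_eq_top_of_isUnit_mem (List.mem_cons_self ..) (h a (List.mem_cons_self ..)),
      Ideal.top_mul, ih fun a' ha' => h a' (List.mem_cons_of_mem a ha')]

/-- **Local form of the centre under a ring map** (e.g. to the local ring at a point): if `f`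
sends all entries of `as` to units then `𝔟(as ++ bs) S = 𝔟(f bs)`.
[cite: Kawasaki2000, proof of Thm. 5.1] -/
theorem map_kawasakiCenter_append_of_isUnit {S : Type u} [CommRing S] (f : R →+* S)
    (as bs : List R) (h : ∀ a ∈ as, IsUnit (f a)) :
    (kawasakiCenter (as ++ bs)).map f = kawasakiCenter (bs.map f) := by
  rw [kawasakiCenter_map, List.map_append,
    kawasakiCenter_append_of_isUnit _ _ (by simpa using h)]

/-- The centre only shrinks when the sequence is extended on the left:
`𝔟(as ++ bs) ⊆ 𝔟(bs)`. [folklore] -/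
theorem kawasakiCenter_append_le (as bs : List R) :
    kawasakiCenter (as ++ bs) ≤ kawasakiCenter bs := by
  induction as with
  | nil => exact le_rfl
  | cons a as ih =>
    rw [List.cons_append, kawasakiCenter_cons]
    exact Ideal.mul_le_left.trans ih

end Literature.AlgebraicGeometry.Resolution
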